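import Mathlib.Analysis.SpecialFunctions.Pow.Deriv
import Mathlib.Analysis.SpecialFunctions.Complex.LogBounds
import Mathlib.Analysis.Complex.RealDeriv
import Mathlib.MeasureTheory.Integral.IntervalIntegral.FundThmCalculus
import Mathlib.Analysis.SpecialFunctions.JapaneseBracket
import Mathlib.MeasureTheory.Measure.Haar.NormedSpace
import Mathlib.MeasureTheory.Group.Integral
import HarnessLib

/-!
# The row kernel `(t + w)^{-1-s} (t + w̄)^{-s}` of the weight-one Eisenstein series: derivatives
# in `t` and norm bounds

Topic `Literature/NumberTheory/EllipticCurves`; namespace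
`Literature.NumberTheory.EllipticCurves.ModularForms`. Definitions with bodies (`rowKernel` and its
first two `t`-derivatives `rowKernel₁`, `rowKernel₂`) and theorems; no named fact.

The rows of Hecke's weight-one Eisenstein series `E₁,χ(z, s)` (`Gamma0EisensteinWeightOne.lean`) are
`∑_d χ(d) (cz+d)⁻¹ (y/|cz+d|²)ˢ = yˢ ∑_d χ(d) k(cz, s; d)` with the **row kernel**

  `k(w, s; t) = (t + w)^{-1-s} (t + w̄)^{-s} = (t + w)⁻¹ |t + w|^{-2s}`   (`t ∈ ℝ`, `Im w > 0`)

(`rowKernel`, `rowKernel_eq_inv_mul_normSq_cpow`). Hecke's convergence trick in the form of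
`PeriodicAbelSummation.lean` (Abel summation twice against the mean-zero periodic weight `χ`)
continues the rows to `Re s > -1` once the SECOND DIFFERENCES of `t ↦ k(w, s; t)` are known to be
`O_s(|t + w|^{-3-2σ})`, `σ = Re s`. This file supplies the calculus:

* `hasDerivAt_rowKernel`, `hasDerivAt_rowKernel₁` — `∂ₜ k = k₁`, `∂ₜ k₁ = k₂` with
  `k₁ = -(1+s)(t+w)^{-2-s}(t+w̄)^{-s} - s (t+w)^{-1-s}(t+w̄)^{-1-s}` and
  `k₂ = (1+s)(2+s)(t+w)^{-3-s}(t+w̄)^{-s} + 2s(1+s)(t+w)^{-2-s}(t+w̄)^{-1-s}`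
  `+ s(1+s)(t+w)^{-1-s}(t+w̄)^{-2-s}`
  (Mathlib `HasDerivAt.cpow_const`, the bases `t + w`, `t + w̄` having non-zero imaginary part);
* `norm_cpow_le_rpow_mul_exp` — `‖zᵃ‖ ≤ |z|^{Re a} e^{π |Im a|}` (`z ≠ 0`);
* `norm_rowKernel_le`, `norm_rowKernel₁_le`, `norm_rowKernel₂_le` —
  `‖k‖ ≤ e^{2π|Im s|} |t+w|^{-1-2σ}`,
  `‖k₁‖ ≤ (1 + 2‖s‖) e^{2π|Im s|} |t+w|^{-2-2σ}`, `‖k₂‖ ≤ 5 (1 + ‖s‖)² e^{2π|Im s|} |t+w|^{-3-2σ}`.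

and then the **second differences** `∇²k(d) = k(d-2) - 2k(d-1) + k(d)` over the integers `d`,
which Abel summation twice (`PeriodicAbelSummation.lean`) needs to be absolutely summable with a
bound decaying in `Im w = η` (the rows `w = cz` are then summable over `c`):

* `secondDiff_rowKernel_eq_integral` — the fundamental theorem of calculus twice:
  `∇²k(d) = ∫_{d-1}^{d} ∫_{t-1}^{t} k₂(u) du dt`; `norm_secondDiff_rowKernel_le_integral` —
  `‖∇²k(d)‖ ≤ ∫_{d-2}^{d} ‖k₂(u)‖ du`;
* `hasSum_intervalIntegral_int` — `∑_{d ∈ ℤ} ∫_{d-1}^{d} g = ∫_ℝ g` for integrable `g`;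
* `integral_norm_ofReal_add_rpow_neg` — `∫_ℝ |u + w|^{-a} du = η^{1-a} ∫_ℝ (1 + v²)^{-a/2} dv`
  (`a > 1`; translation, the dilation `u = ηv`, and Mathlib's
  `integrable_rpow_neg_one_add_norm_sq`);
* `summable_norm_secondDiff_rowKernel`, `tsum_norm_secondDiff_rowKernel_le` — **the row bound**
  `∑_d ‖∇²k(w, s; d)‖ ≤ 10 (1+‖s‖)² e^{2π|Im s|} I(3+2σ) η^{-2-2σ}` for `σ > -1`,
  `I(a) = ∫_ℝ (1+v²)^{-a/2} dv`.

The continuation of the rows and of `E₁,χ(z, s)` is the next file. Everything here is proved from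
Mathlib.

## References

* E. Hecke, *Theorie der Eisensteinschen Reihen höherer Stufe…*, Abh. Math. Sem. Hamburg 5 (1927),
  §2 (the convergence factor `|cz + d|^{-2s}`).
* B. Schoeneberg, *Elliptic Modular Functions*, Springer (1974), Ch. VII §2.
-/

noncomputable section

open Complex Real Set MeasureTheory intervalIntegral Filter
open scoped ComplexConjugate Topology

namespace Literature.NumberTheory.EllipticCurves.ModularForms

/-! ### Complex powers: a norm bound and the product `z^{-s} (z̄)^{-s} = |z|^{-2s}` -/

/-- `‖zᵃ‖ ≤ |z|^{Re a} · e^{π |Im a|}` for `z ≠ 0` (`‖zᵃ‖ = |z|^{Re a} e^{-arg z · Im a}` and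
`|arg z| ≤ π`). [folklore] -/
theorem norm_cpow_le_rpow_mul_exp {z : ℂ} (hz : z ≠ 0) (a : ℂ) :
    ‖z ^ a‖ ≤ ‖z‖ ^ a.re * Real.exp (π * |a.im|) := by
  rw [norm_cpow_of_ne_zero hz, div_eq_mul_inv, ← Real.exp_neg]
  refine mul_le_mul_of_nonneg_left (Real.exp_le_exp.mpr ?_) (Real.rpow_nonneg (norm_nonneg _) _)
  have h1 : -(arg z * a.im) ≤ |arg z * a.im| := neg_le_abs _
  rw [abs_mul] at h1
  have h2 : |arg z| * |a.im| ≤ π * |a.im| :=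
    mul_le_mul_of_nonneg_right (abs_arg_le_pi z) (abs_nonneg _)
  linarith

/-- For `Im z ≠ 0`: `z^{-s} · (z̄)^{-s} = (|z|²)^{-s}` (the arguments of `z` and `z̄` cancel).
[folklore] -/
theorem cpow_neg_mul_conj_cpow_neg {z : ℂ} (hz : z.im ≠ 0) (s : ℂ) :
    z ^ (-s) * (conj z) ^ (-s) = ((‖z‖ ^ 2 : ℝ) : ℂ) ^ (-s) := by
  have hz0 : z ≠ 0 := fun h ↦ hz (by rw [h, zero_im])
  have harg : z.arg ≠ π := fun h ↦ hz ((arg_eq_pi_iff.mp h).2)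
  have hn : (0 : ℝ) < ‖z‖ ^ 2 := by positivity
  have hn0 : ((‖z‖ ^ 2 : ℝ) : ℂ) ≠ 0 := by exact_mod_cast hn.ne'
  have h1 : (conj z) ^ (-s) = conj (z ^ (-(conj s))) := by rw [conj_cpow z (-s) harg, map_neg]
  have h2 : z ^ (-s) = exp (log z * (-s)) := cpow_def_of_ne_zero hz0 _
  have h3 : z ^ (-(conj s)) = exp (log z * (-(conj s))) := cpow_def_of_ne_zero hz0 _
  have h4 : conj (exp (log z * -(conj s))) = exp (conj (log z) * (-s)) := by
    rw [← exp_conj, map_mul, map_neg, Complex.conj_conj]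
  have h5 : ((‖z‖ ^ 2 : ℝ) : ℂ) ^ (-s) = exp (log ((‖z‖ ^ 2 : ℝ) : ℂ) * (-s)) :=
    cpow_def_of_ne_zero hn0 _
  have h6 : log ((‖z‖ ^ 2 : ℝ) : ℂ) = ((Real.log (‖z‖ ^ 2) : ℝ) : ℂ) := (ofReal_log hn.le).symm
  have h7 : Real.log (‖z‖ ^ 2) = 2 * Real.log ‖z‖ := by
    rw [Real.log_pow]; norm_num
  have h8 : log z + conj (log z) = ((2 * Real.log ‖z‖ : ℝ) : ℂ) := by
    rw [add_conj, log_re]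
  rw [h1, h3, h4, h2, ← Complex.exp_add, h5, h6, h7]
  congr 1
  rw [show log z * -s + conj (log z) * -s = (log z + conj (log z)) * -s by ring, h8]

/-! ### The row kernel and its first two derivatives in `t` -/

/-- **The row kernel** `k(w, s; t) = (t + w)^{-1-s} (t + w̄)^{-s}` of the weight-one Eisenstein
series (principal powers; for `Im w > 0` and real `t` this is `(t + w)⁻¹ |t + w|^{-2s}`,
`rowKernel_eq_inv_mul_normSq_cpow`). [folklore] -/
def rowKernel (w s : ℂ) (t : ℝ) : ℂ :=
  ((t : ℂ) + w) ^ (-1 - s) * ((t : ℂ) + conj w) ^ (-s)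

/-- `∂ₜ k`: `k₁ = -(1+s)(t+w)^{-2-s}(t+w̄)^{-s} - s(t+w)^{-1-s}(t+w̄)^{-1-s}`. [folklore] -/
def rowKernel₁ (w s : ℂ) (t : ℝ) : ℂ :=
  (-1 - s) * ((t : ℂ) + w) ^ (-2 - s) * ((t : ℂ) + conj w) ^ (-s) +
    (-s) * ((t : ℂ) + w) ^ (-1 - s) * ((t : ℂ) + conj w) ^ (-1 - s)

/-- `∂ₜ² k`: `k₂ = (1+s)(2+s)(t+w)^{-3-s}(t+w̄)^{-s} + 2s(1+s)(t+w)^{-2-s}(t+w̄)^{-1-s}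
+ s(1+s)(t+w)^{-1-s}(t+w̄)^{-2-s}`. [folklore] -/
def rowKernel₂ (w s : ℂ) (t : ℝ) : ℂ :=
  (-1 - s) * (-2 - s) * ((t : ℂ) + w) ^ (-3 - s) * ((t : ℂ) + conj w) ^ (-s) +
    2 * ((-1 - s) * (-s)) * ((t : ℂ) + w) ^ (-2 - s) * ((t : ℂ) + conj w) ^ (-1 - s) +
    (-s) * (-1 - s) * ((t : ℂ) + w) ^ (-1 - s) * ((t : ℂ) + conj w) ^ (-2 - s)

section Basic

variable {w : ℂ} (hw : 0 < w.im)
include hw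

/-- `t + w` has positive imaginary part. [folklore] -/
theorem im_ofReal_add_pos (t : ℝ) : 0 < ((t : ℂ) + w).im := by simpa using hw

/-- `t + w̄` has negative imaginary part. [folklore] -/
theorem im_ofReal_add_conj_neg (t : ℝ) : ((t : ℂ) + conj w).im < 0 := by
  simpa using hw

/-- `t + w ≠ 0`. [folklore] -/
theorem ofReal_add_ne_zero (t : ℝ) : (t : ℂ) + w ≠ 0 :=
  fun h ↦ (im_ofReal_add_pos hw t).ne' (by rw [h, zero_im])

/-- `t + w̄ ≠ 0`. [folklore] -/
theorem ofReal_add_conj_ne_zero (t : ℝ) : (t : ℂ) + conj w ≠ 0 :=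
  fun h ↦ (im_ofReal_add_conj_neg hw t).ne (by rw [h, zero_im])

/-- `t + w` lies in the slit plane. [folklore] -/
theorem ofReal_add_mem_slitPlane (t : ℝ) : (t : ℂ) + w ∈ slitPlane :=
  Or.inr (im_ofReal_add_pos hw t).ne'

/-- `t + w̄` lies in the slit plane. [folklore] -/
theorem ofReal_add_conj_mem_slitPlane (t : ℝ) : (t : ℂ) + conj w ∈ slitPlane :=
  Or.inr (im_ofReal_add_conj_neg hw t).ne

omit hw in
/-- `t + w̄ = conj (t + w)`. [folklore] -/
theorem ofReal_add_conj_eq (t : ℝ) : (t : ℂ) + conj w = conj ((t : ℂ) + w) := by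
  rw [map_add, conj_ofReal]

omit hw in
/-- `|t + w̄| = |t + w|`. [folklore] -/
theorem norm_ofReal_add_conj (t : ℝ) : ‖(t : ℂ) + conj w‖ = ‖(t : ℂ) + w‖ := by
  rw [ofReal_add_conj_eq, norm_conj]

/-- **`k(w, s; t) = (t + w)⁻¹ (|t + w|²)^{-s}`** for real `t` and `Im w > 0`. [folklore] -/
theorem rowKernel_eq_inv_mul_normSq_cpow (s : ℂ) (t : ℝ) :
    rowKernel w s t = ((t : ℂ) + w)⁻¹ * ((‖(t : ℂ) + w‖ ^ 2 : ℝ) : ℂ) ^ (-s) := by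
  unfold rowKernel
  rw [ofReal_add_conj_eq, show (-1 - s) = (-1) + (-s) by ring,
    cpow_add _ _ (ofReal_add_ne_zero hw t), cpow_neg_one, mul_assoc,
    cpow_neg_mul_conj_cpow_neg (im_ofReal_add_pos hw t).ne' s]

/-- The same with the base written as `Im`-free quotient: `(|t+w|²)^{-s} = ((|t+w|²)⁻¹)^{s}`.
[folklore] -/
theorem rowKernel_eq_inv_mul_inv_cpow (s : ℂ) (t : ℝ) :
    rowKernel w s t = ((t : ℂ) + w)⁻¹ * (((‖(t : ℂ) + w‖ ^ 2)⁻¹ : ℝ) : ℂ) ^ s := by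
  rw [rowKernel_eq_inv_mul_normSq_cpow hw]
  congr 1
  have hpos : (0 : ℝ) < ‖(t : ℂ) + w‖ ^ 2 := by
    have := norm_pos_iff.mpr (ofReal_add_ne_zero hw t); positivity
  have harg : (((‖(t : ℂ) + w‖ ^ 2 : ℝ)) : ℂ).arg ≠ π := by
    rw [arg_ofReal_of_nonneg hpos.le]; exact Real.pi_ne_zero.symm
  rw [ofReal_inv, inv_cpow _ _ harg, cpow_neg]

/-- **`∂ₜ k = k₁`.** [folklore] -/
theorem hasDerivAt_rowKernel (s : ℂ) (t : ℝ) :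
    HasDerivAt (rowKernel w s) (rowKernel₁ w s t) t := by
  -- the two factors as functions of a COMPLEX variable, differentiated at `↑t`
  have hA : HasDerivAt (fun u : ℂ ↦ (u + w) ^ (-1 - s))
      ((-1 - s) * ((t : ℂ) + w) ^ (-1 - s - 1) * 1) (t : ℂ) :=
    ((hasDerivAt_id (t : ℂ)).add_const w).cpow_const (ofReal_add_mem_slitPlane hw t)
  have hB : HasDerivAt (fun u : ℂ ↦ (u + conj w) ^ (-s))
      ((-s) * ((t : ℂ) + conj w) ^ (-s - 1) * 1) (t : ℂ) :=
    ((hasDerivAt_id (t : ℂ)).add_const (conj w)).cpow_const (ofReal_add_conj_mem_slitPlane hw t)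
  have hAB := (hA.mul hB).comp_ofReal
  have h1 := hAB.congr_of_eventuallyEq (f₁ := rowKernel w s)
    (Filter.Eventually.of_forall fun y ↦ by simp only [rowKernel, Pi.mul_apply])
  refine h1.congr_deriv ?_
  unfold rowKernel₁
  rw [show (-1 - s - 1) = (-2 - s) by ring, show (-s - 1) = (-1 - s) by ring]
  ring

/-- **`∂ₜ k₁ = k₂`.** [folklore] -/
theorem hasDerivAt_rowKernel₁ (s : ℂ) (t : ℝ) :
    HasDerivAt (rowKernel₁ w s) (rowKernel₂ w s t) t := by
  have hA2 : HasDerivAt (fun u : ℂ ↦ (u + w) ^ (-2 - s))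
      ((-2 - s) * ((t : ℂ) + w) ^ (-2 - s - 1) * 1) (t : ℂ) :=
    ((hasDerivAt_id (t : ℂ)).add_const w).cpow_const (ofReal_add_mem_slitPlane hw t)
  have hA1 : HasDerivAt (fun u : ℂ ↦ (u + w) ^ (-1 - s))
      ((-1 - s) * ((t : ℂ) + w) ^ (-1 - s - 1) * 1) (t : ℂ) :=
    ((hasDerivAt_id (t : ℂ)).add_const w).cpow_const (ofReal_add_mem_slitPlane hw t)
  have hB0 : HasDerivAt (fun u : ℂ ↦ (u + conj w) ^ (-s))
      ((-s) * ((t : ℂ) + conj w) ^ (-s - 1) * 1) (t : ℂ) :=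
    ((hasDerivAt_id (t : ℂ)).add_const (conj w)).cpow_const (ofReal_add_conj_mem_slitPlane hw t)
  have hB1 : HasDerivAt (fun u : ℂ ↦ (u + conj w) ^ (-1 - s))
      ((-1 - s) * ((t : ℂ) + conj w) ^ (-1 - s - 1) * 1) (t : ℂ) :=
    ((hasDerivAt_id (t : ℂ)).add_const (conj w)).cpow_const (ofReal_add_conj_mem_slitPlane hw t)
  have h := (((hA2.mul hB0).const_mul (-1 - s)).add ((hA1.mul hB1).const_mul (-s))).comp_ofReal
  have h1 := h.congr_of_eventuallyEq (f₁ := rowKernel₁ w s)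
    (Filter.Eventually.of_forall fun y ↦ by
      simp only [rowKernel₁, Pi.add_apply, Pi.mul_apply]; ring)
  refine h1.congr_deriv ?_
  unfold rowKernel₂
  rw [show (-2 - s - 1) = (-3 - s) by ring, show (-s - 1) = (-1 - s) by ring,
    show (-1 - s - 1) = (-2 - s) by ring]
  ring

/-! ### Norm bounds -/

/-- `‖(t+w)ᵃ‖ ≤ |t+w|^{Re a} e^{π|Im a|}`. [folklore] -/
theorem norm_ofReal_add_cpow_le (a : ℂ) (t : ℝ) :
    ‖((t : ℂ) + w) ^ a‖ ≤ ‖(t : ℂ) + w‖ ^ a.re * Real.exp (π * |a.im|) :=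
  norm_cpow_le_rpow_mul_exp (ofReal_add_ne_zero hw t) a

/-- `‖(t+w̄)ᵃ‖ ≤ |t+w|^{Re a} e^{π|Im a|}`. [folklore] -/
theorem norm_ofReal_add_conj_cpow_le (a : ℂ) (t : ℝ) :
    ‖((t : ℂ) + conj w) ^ a‖ ≤ ‖(t : ℂ) + w‖ ^ a.re * Real.exp (π * |a.im|) := by
  rw [← norm_ofReal_add_conj t]
  exact norm_cpow_le_rpow_mul_exp (ofReal_add_conj_ne_zero hw t) a

/-- The product bound: `‖(t+w)ᵃ (t+w̄)ᵇ‖ ≤ |t+w|^{Re a + Re b} e^{π(|Im a| + |Im b|)}`.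
[folklore] -/
theorem norm_cpow_mul_cpow_le (a b : ℂ) (t : ℝ) :
    ‖((t : ℂ) + w) ^ a * ((t : ℂ) + conj w) ^ b‖ ≤
      ‖(t : ℂ) + w‖ ^ (a.re + b.re) * Real.exp (π * (|a.im| + |b.im|)) := by
  have hL : 0 < ‖(t : ℂ) + w‖ := norm_pos_iff.mpr (ofReal_add_ne_zero hw t)
  rw [norm_mul, Real.rpow_add hL, mul_add, Real.exp_add]
  calc ‖((t : ℂ) + w) ^ a‖ * ‖((t : ℂ) + conj w) ^ b‖
      ≤ (‖(t : ℂ) + w‖ ^ a.re * Real.exp (π * |a.im|)) *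
          (‖(t : ℂ) + w‖ ^ b.re * Real.exp (π * |b.im|)) :=
        mul_le_mul (norm_ofReal_add_cpow_le hw a t) (norm_ofReal_add_conj_cpow_le hw b t)
          (norm_nonneg _) (by positivity)
    _ = ‖(t : ℂ) + w‖ ^ a.re * ‖(t : ℂ) + w‖ ^ b.re *
          (Real.exp (π * |a.im|) * Real.exp (π * |b.im|)) := by ring

omit hw in
/-- `|Im(-n - s)| = |Im s|` for real `n`. [folklore] -/
theorem abs_im_neg_sub (n : ℝ) (s : ℂ) : |((-n : ℂ) - s).im| = |s.im| := by
  simp [abs_neg]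

/-- **`‖k(w, s; t)‖ ≤ e^{2π|Im s|} |t + w|^{-1-2σ}`.** [folklore] -/
theorem norm_rowKernel_le (s : ℂ) (t : ℝ) :
    ‖rowKernel w s t‖ ≤ Real.exp (2 * π * |s.im|) * ‖(t : ℂ) + w‖ ^ (-1 - 2 * s.re) := by
  unfold rowKernel
  refine (norm_cpow_mul_cpow_le hw _ _ t).trans (le_of_eq ?_)
  have h1 : (-1 - s).re + (-s).re = -1 - 2 * s.re := by simp; ring
  have h2 : |(-1 - s).im| + |(-s).im| = 2 * |s.im| := by simp [abs_neg]; ring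
  rw [h1, h2]; ring

/-- **`‖k₁(w, s; t)‖ ≤ (1 + 2‖s‖) e^{2π|Im s|} |t + w|^{-2-2σ}`.** [folklore] -/
theorem norm_rowKernel₁_le (s : ℂ) (t : ℝ) :
    ‖rowKernel₁ w s t‖ ≤
      (1 + 2 * ‖s‖) * Real.exp (2 * π * |s.im|) * ‖(t : ℂ) + w‖ ^ (-2 - 2 * s.re) := by
  unfold rowKernel₁
  set E : ℝ := Real.exp (2 * π * |s.im|) * ‖(t : ℂ) + w‖ ^ (-2 - 2 * s.re) with hE
  have hE0 : 0 ≤ E := by positivity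
  have hT1 : ‖(-1 - s) * ((t : ℂ) + w) ^ (-2 - s) * ((t : ℂ) + conj w) ^ (-s)‖ ≤ (1 + ‖s‖) * E := by
    rw [mul_assoc, norm_mul]
    refine mul_le_mul ?_ ((norm_cpow_mul_cpow_le hw _ _ t).trans (le_of_eq ?_)) (norm_nonneg _)
      (by positivity)
    · calc ‖(-1 - s : ℂ)‖ = ‖(1 : ℂ) + s‖ := by rw [show (-1 - s : ℂ) = -(1 + s) by ring, norm_neg]
        _ ≤ ‖(1 : ℂ)‖ + ‖s‖ := norm_add_le _ _
        _ = 1 + ‖s‖ := by rw [norm_one]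
    · have h1 : (-2 - s).re + (-s).re = -2 - 2 * s.re := by simp; ring
      have h2 : |(-2 - s).im| + |(-s).im| = 2 * |s.im| := by simp [abs_neg]; ring
      rw [h1, h2, hE]; ring
  have hT2 : ‖(-s) * ((t : ℂ) + w) ^ (-1 - s) * ((t : ℂ) + conj w) ^ (-1 - s)‖ ≤ ‖s‖ * E := by
    rw [mul_assoc, norm_mul, norm_neg]
    refine mul_le_mul_of_nonneg_left ((norm_cpow_mul_cpow_le hw _ _ t).trans (le_of_eq ?_))
      (norm_nonneg _)
    have h1 : (-1 - s).re + (-1 - s).re = -2 - 2 * s.re := by simp; ring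
    have h2 : |(-1 - s).im| + |(-1 - s).im| = 2 * |s.im| := by simp [abs_neg]; ring
    rw [h1, h2, hE]; ring
  calc _ ≤ (1 + ‖s‖) * E + ‖s‖ * E := norm_add_le_of_le hT1 hT2
    _ = (1 + 2 * ‖s‖) * Real.exp (2 * π * |s.im|) * ‖(t : ℂ) + w‖ ^ (-2 - 2 * s.re) := by
        rw [hE]; ring

/-- **`‖k₂(w, s; t)‖ ≤ 5 (1 + ‖s‖)² e^{2π|Im s|} |t + w|^{-3-2σ}`.** [folklore] -/
theorem norm_rowKernel₂_le (s : ℂ) (t : ℝ) :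
    ‖rowKernel₂ w s t‖ ≤
      5 * (1 + ‖s‖) ^ 2 * Real.exp (2 * π * |s.im|) * ‖(t : ℂ) + w‖ ^ (-3 - 2 * s.re) := by
  unfold rowKernel₂
  set E : ℝ := Real.exp (2 * π * |s.im|) * ‖(t : ℂ) + w‖ ^ (-3 - 2 * s.re) with hE
  have hE0 : 0 ≤ E := by positivity
  have hs1 : ‖(-1 - s : ℂ)‖ ≤ 1 + ‖s‖ := by
    calc ‖(-1 - s : ℂ)‖ = ‖(1 : ℂ) + s‖ := by rw [show (-1 - s : ℂ) = -(1 + s) by ring, norm_neg]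
      _ ≤ ‖(1 : ℂ)‖ + ‖s‖ := norm_add_le _ _
      _ = 1 + ‖s‖ := by rw [norm_one]
  have hs2 : ‖(-2 - s : ℂ)‖ ≤ 2 * (1 + ‖s‖) := by
    calc ‖(-2 - s : ℂ)‖ = ‖(2 : ℂ) + s‖ := by rw [show (-2 - s : ℂ) = -(2 + s) by ring, norm_neg]
      _ ≤ ‖(2 : ℂ)‖ + ‖s‖ := norm_add_le _ _
      _ = 2 + ‖s‖ := by rw [Complex.norm_ofNat]
      _ ≤ 2 * (1 + ‖s‖) := by linarith [norm_nonneg s]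
  have hs0 : ‖(-s : ℂ)‖ ≤ 1 + ‖s‖ := by rw [norm_neg]; linarith [norm_nonneg s]
  have hT1 : ‖(-1 - s) * (-2 - s) * ((t : ℂ) + w) ^ (-3 - s) * ((t : ℂ) + conj w) ^ (-s)‖ ≤
      2 * (1 + ‖s‖) ^ 2 * E := by
    rw [mul_assoc, norm_mul, norm_mul]
    refine mul_le_mul ?_ ((norm_cpow_mul_cpow_le hw _ _ t).trans (le_of_eq ?_)) (norm_nonneg _)
      (by positivity)
    · calc ‖(-1 - s : ℂ)‖ * ‖(-2 - s : ℂ)‖ ≤ (1 + ‖s‖) * (2 * (1 + ‖s‖)) :=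
            mul_le_mul hs1 hs2 (norm_nonneg _) (by positivity)
        _ = 2 * (1 + ‖s‖) ^ 2 := by ring
    · have h1 : (-3 - s).re + (-s).re = -3 - 2 * s.re := by simp; ring
      have h2 : |(-3 - s).im| + |(-s).im| = 2 * |s.im| := by simp [abs_neg]; ring
      rw [h1, h2, hE]; ring
  have hT2 : ‖2 * ((-1 - s) * (-s)) * ((t : ℂ) + w) ^ (-2 - s) * ((t : ℂ) + conj w) ^ (-1 - s)‖ ≤
      2 * (1 + ‖s‖) ^ 2 * E := by
    rw [mul_assoc, norm_mul, norm_mul, norm_mul, Complex.norm_ofNat]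
    refine mul_le_mul ?_ ((norm_cpow_mul_cpow_le hw _ _ t).trans (le_of_eq ?_)) (norm_nonneg _)
      (by positivity)
    · calc 2 * (‖(-1 - s : ℂ)‖ * ‖(-s : ℂ)‖) ≤ 2 * ((1 + ‖s‖) * (1 + ‖s‖)) :=
            mul_le_mul_of_nonneg_left (mul_le_mul hs1 hs0 (norm_nonneg _) (by positivity))
              (by norm_num)
        _ = 2 * (1 + ‖s‖) ^ 2 := by ring
    · have h1 : (-2 - s).re + (-1 - s).re = -3 - 2 * s.re := by simp; ring
      have h2 : |(-2 - s).im| + |(-1 - s).im| = 2 * |s.im| := by simp [abs_neg]; ring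
      rw [h1, h2, hE]; ring
  have hT3 : ‖(-s) * (-1 - s) * ((t : ℂ) + w) ^ (-1 - s) * ((t : ℂ) + conj w) ^ (-2 - s)‖ ≤
      (1 + ‖s‖) ^ 2 * E := by
    rw [mul_assoc, norm_mul, norm_mul]
    refine mul_le_mul ?_ ((norm_cpow_mul_cpow_le hw _ _ t).trans (le_of_eq ?_)) (norm_nonneg _)
      (by positivity)
    · calc ‖(-s : ℂ)‖ * ‖(-1 - s : ℂ)‖ ≤ (1 + ‖s‖) * (1 + ‖s‖) :=
            mul_le_mul hs0 hs1 (norm_nonneg _) (by positivity)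
        _ = (1 + ‖s‖) ^ 2 := by ring
    · have h1 : (-1 - s).re + (-2 - s).re = -3 - 2 * s.re := by simp; ring
      have h2 : |(-1 - s).im| + |(-2 - s).im| = 2 * |s.im| := by simp [abs_neg]; ring
      rw [h1, h2, hE]; ring
  calc _ ≤ 2 * (1 + ‖s‖) ^ 2 * E + 2 * (1 + ‖s‖) ^ 2 * E + (1 + ‖s‖) ^ 2 * E :=
        norm_add₃_le.trans (add_le_add_three hT1 hT2 hT3)
    _ = 5 * (1 + ‖s‖) ^ 2 * Real.exp (2 * π * |s.im|) * ‖(t : ℂ) + w‖ ^ (-3 - 2 * s.re) := by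
        rw [hE]; ring

end Basic

section Differences

variable {w : ℂ} (hw : 0 < w.im)
include hw

/-! ### Continuity of the kernel and of its derivatives -/

/-- `t ↦ (t + w)ᵃ` is continuous. [folklore] -/
theorem continuous_ofReal_add_cpow (a : ℂ) : Continuous fun t : ℝ ↦ ((t : ℂ) + w) ^ a := by
  have hf : Continuous fun t : ℝ ↦ (t : ℂ) + w := continuous_ofReal.add continuous_const
  refine continuous_iff_continuousAt.mpr fun t ↦ ?_
  have h1 : ContinuousAt (fun z : ℂ ↦ z ^ a) ((t : ℂ) + w) :=
    continuousAt_cpow_const (ofReal_add_mem_slitPlane hw t)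
  exact h1.comp (f := fun t : ℝ ↦ (t : ℂ) + w) hf.continuousAt

/-- `t ↦ (t + w̄)ᵃ` is continuous. [folklore] -/
theorem continuous_ofReal_add_conj_cpow (a : ℂ) :
    Continuous fun t : ℝ ↦ ((t : ℂ) + conj w) ^ a := by
  have hf : Continuous fun t : ℝ ↦ (t : ℂ) + conj w := continuous_ofReal.add continuous_const
  refine continuous_iff_continuousAt.mpr fun t ↦ ?_
  have h1 : ContinuousAt (fun z : ℂ ↦ z ^ a) ((t : ℂ) + conj w) :=
    continuousAt_cpow_const (ofReal_add_conj_mem_slitPlane hw t)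
  exact h1.comp (f := fun t : ℝ ↦ (t : ℂ) + conj w) hf.continuousAt

/-- `k₁` is continuous in `t`. [folklore] -/
theorem continuous_rowKernel₁ (s : ℂ) : Continuous (rowKernel₁ w s) := by
  unfold rowKernel₁
  exact ((continuous_const.mul (continuous_ofReal_add_cpow hw _)).mul
    (continuous_ofReal_add_conj_cpow hw _)).add
    ((continuous_const.mul (continuous_ofReal_add_cpow hw _)).mul
      (continuous_ofReal_add_conj_cpow hw _))

/-- `k₂` is continuous in `t`. [folklore] -/
theorem continuous_rowKernel₂ (s : ℂ) : Continuous (rowKernel₂ w s) := by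
  unfold rowKernel₂
  exact (((continuous_const.mul (continuous_ofReal_add_cpow hw _)).mul
    (continuous_ofReal_add_conj_cpow hw _)).add
    ((continuous_const.mul (continuous_ofReal_add_cpow hw _)).mul
      (continuous_ofReal_add_conj_cpow hw _))).add
    ((continuous_const.mul (continuous_ofReal_add_cpow hw _)).mul
      (continuous_ofReal_add_conj_cpow hw _))

/-! ### The second difference as a double integral of `k₂` -/

/-- FTC: `k(b) - k(a) = ∫ₐᵇ k₁`. [folklore] -/
theorem rowKernel_sub_eq_integral (s : ℂ) (a b : ℝ) :
    rowKernel w s b - rowKernel w s a = ∫ t in a..b, rowKernel₁ w s t :=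
  (integral_eq_sub_of_hasDerivAt (fun t _ ↦ hasDerivAt_rowKernel hw s t)
    ((continuous_rowKernel₁ hw s).intervalIntegrable _ _)).symm

/-- FTC: `k₁(b) - k₁(a) = ∫ₐᵇ k₂`. [folklore] -/
theorem rowKernel₁_sub_eq_integral (s : ℂ) (a b : ℝ) :
    rowKernel₁ w s b - rowKernel₁ w s a = ∫ u in a..b, rowKernel₂ w s u :=
  (integral_eq_sub_of_hasDerivAt (fun t _ ↦ hasDerivAt_rowKernel₁ hw s t)
    ((continuous_rowKernel₂ hw s).intervalIntegrable _ _)).symm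

/-- **The second difference is a double integral of `k₂`**:
`k(d-2) - 2k(d-1) + k(d) = ∫_{d-1}^{d} ∫_{t-1}^{t} k₂(u) du dt`. [folklore] -/
theorem secondDiff_rowKernel_eq_integral (s : ℂ) (d : ℝ) :
    rowKernel w s (d - 2) - 2 * rowKernel w s (d - 1) + rowKernel w s d =
      ∫ t in (d - 1)..d, ∫ u in (t - 1)..t, rowKernel₂ w s u := by
  have h1 : ∫ t in (d - 1)..d, ∫ u in (t - 1)..t, rowKernel₂ w s u =
      ∫ t in (d - 1)..d, (rowKernel₁ w s t - rowKernel₁ w s (t - 1)) :=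
    integral_congr fun t _ ↦ (rowKernel₁_sub_eq_integral hw s (t - 1) t).symm
  have hc1 : Continuous fun t : ℝ ↦ rowKernel₁ w s (t - 1) :=
    (continuous_rowKernel₁ hw s).comp (continuous_sub_right 1)
  rw [h1, intervalIntegral.integral_sub ((continuous_rowKernel₁ hw s).intervalIntegrable _ _)
    (hc1.intervalIntegrable _ _),
    intervalIntegral.integral_comp_sub_right (fun t ↦ rowKernel₁ w s t) 1,
    ← rowKernel_sub_eq_integral hw, ← rowKernel_sub_eq_integral hw]
  ring_nf

/-- **`‖∇²k(d)‖ ≤ ∫_{d-2}^{d} ‖k₂(u)‖ du`.** [folklore] -/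
theorem norm_secondDiff_rowKernel_le_integral (s : ℂ) (d : ℝ) :
    ‖rowKernel w s (d - 2) - 2 * rowKernel w s (d - 1) + rowKernel w s d‖ ≤
      ∫ u in (d - 2)..d, ‖rowKernel₂ w s u‖ := by
  rw [secondDiff_rowKernel_eq_integral hw]
  have hcont : Continuous fun u ↦ ‖rowKernel₂ w s u‖ := (continuous_rowKernel₂ hw s).norm
  have hpt : ∀ t ∈ Set.Ioc (d - 1) d,
      ‖∫ u in (t - 1)..t, rowKernel₂ w s u‖ ≤ ∫ u in (d - 2)..d, ‖rowKernel₂ w s u‖ := by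
    intro t ht
    calc ‖∫ u in (t - 1)..t, rowKernel₂ w s u‖ ≤ ∫ u in (t - 1)..t, ‖rowKernel₂ w s u‖ :=
          norm_integral_le_integral_norm (by linarith)
      _ ≤ ∫ u in (d - 2)..d, ‖rowKernel₂ w s u‖ :=
          integral_mono_interval (by linarith [ht.1]) (by linarith) ht.2
            (Eventually.of_forall fun _ ↦ norm_nonneg _) (hcont.intervalIntegrable _ _)
  calc ‖∫ t in (d - 1)..d, ∫ u in (t - 1)..t, rowKernel₂ w s u‖
      ≤ ∫ t in (d - 1)..d, (∫ u in (d - 2)..d, ‖rowKernel₂ w s u‖) :=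
        norm_integral_le_of_norm_le (by linarith) (Eventually.of_forall hpt)
          intervalIntegrable_const
    _ = ∫ u in (d - 2)..d, ‖rowKernel₂ w s u‖ := by
        rw [intervalIntegral.integral_const, show d - (d - 1) = (1 : ℝ) by ring, one_smul]

end Differences

/-! ### Summing integrals over the intervals `[d - 1, d]`, `d ∈ ℤ` -/

section IntervalSums

/-- The intervals `(d - 1, d]`, `d ∈ ℤ`, are pairwise disjoint. [folklore] -/
theorem pairwise_disjoint_Ioc_int :
    Pairwise (Function.onFun Disjoint fun d : ℤ ↦ Set.Ioc ((d : ℝ) - 1) d) := by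
  intro d e hde
  simp only [Function.onFun, Set.disjoint_left, Set.mem_Ioc]
  rintro x ⟨h1, h2⟩ ⟨h3, h4⟩
  apply hde
  have h5 : (d : ℝ) < e + 1 := by linarith
  have h6 : (e : ℝ) < d + 1 := by linarith
  have h7 : d < e + 1 := by exact_mod_cast h5
  have h8 : e < d + 1 := by exact_mod_cast h6
  omega

/-- The intervals `(d - 1, d]`, `d ∈ ℤ`, cover `ℝ` (`x ∈ (⌈x⌉ - 1, ⌈x⌉]`). [folklore] -/
theorem iUnion_Ioc_int_eq_univ : (⋃ d : ℤ, Set.Ioc ((d : ℝ) - 1) d) = Set.univ := by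
  refine Set.eq_univ_of_forall fun x ↦ Set.mem_iUnion.mpr ⟨⌈x⌉, ?_, Int.le_ceil x⟩
  linarith [Int.ceil_lt_add_one x]

/-- **`∑_{d ∈ ℤ} ∫_{d-1}^{d} g = ∫_ℝ g`** for an integrable `g`. [folklore] -/
theorem hasSum_intervalIntegral_int {E : Type*} [NormedAddCommGroup E] [NormedSpace ℝ E]
    {g : ℝ → E} (hg : Integrable g) :
    HasSum (fun d : ℤ ↦ ∫ u in ((d : ℝ) - 1)..d, g u) (∫ u, g u) := by
  have h := hasSum_integral_iUnion (fun d : ℤ ↦ (measurableSet_Ioc : MeasurableSet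
    (Set.Ioc ((d : ℝ) - 1) d))) pairwise_disjoint_Ioc_int hg.integrableOn
  rw [iUnion_Ioc_int_eq_univ, setIntegral_univ] at h
  refine h.congr_fun fun d ↦ ?_
  exact intervalIntegral.integral_of_le (f := g) (μ := volume)
    (show (d : ℝ) - 1 ≤ d by linarith)

/-- `∑_{d ∈ ℤ} ∫_{d-2}^{d} g = 2 ∫_ℝ g` for an integrable `g`. [folklore] -/
theorem hasSum_intervalIntegral_two_int {E : Type*} [NormedAddCommGroup E] [NormedSpace ℝ E]
    {g : ℝ → E} (hg : Integrable g) :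
    HasSum (fun d : ℤ ↦ ∫ u in ((d : ℝ) - 2)..d, g u) ((2 : ℝ) • ∫ u, g u) := by
  have h1 := hasSum_intervalIntegral_int hg
  have h2 : HasSum (fun d : ℤ ↦ ∫ u in ((d : ℝ) - 2)..((d : ℝ) - 1), g u) (∫ u, g u) := by
    have := (Equiv.subRight (1 : ℤ)).hasSum_iff.mpr h1
    refine this.congr_fun fun d ↦ ?_
    simp only [Function.comp_apply, Equiv.subRight_apply, Int.cast_sub, Int.cast_one]
    ring_nf
  have h3 := h2.add h1
  rw [← two_smul ℝ (∫ u, g u)] at h3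
  refine h3.congr_fun fun d ↦ ?_
  exact (intervalIntegral.integral_add_adjacent_intervals (hg.intervalIntegrable)
    (hg.intervalIntegrable)).symm

end IntervalSums

/-! ### The integral `∫_ℝ |u + w|^{-a} du = (Im w)^{1-a} ∫_ℝ (1 + v²)^{-a/2} dv` -/

section Integral

variable {w : ℂ} (hw : 0 < w.im)
include hw

omit hw in
/-- `|u + w|² = (u + Re w)² + (Im w)²`. [folklore] -/
theorem norm_sq_ofReal_add (u : ℝ) : ‖(u : ℂ) + w‖ ^ 2 = (u + w.re) ^ 2 + w.im ^ 2 := by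
  rw [Complex.sq_norm, normSq_apply]
  simp
  ring

omit hw in
/-- `|u + w|^{-a} = ((u + Re w)² + (Im w)²)^{-a/2}`. [folklore] -/
theorem norm_ofReal_add_rpow_neg (a u : ℝ) :
    ‖(u : ℂ) + w‖ ^ (-a) = ((u + w.re) ^ 2 + w.im ^ 2) ^ (-a / 2) := by
  rw [← norm_sq_ofReal_add, ← Real.rpow_natCast, ← Real.rpow_mul (norm_nonneg _)]
  norm_num
  ring_nf

omit hw in
/-- `(1 + v²)^{-a/2}` is integrable on `ℝ` for `a > 1` (Mathlib's Japanese bracket). [folklore] -/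
theorem integrable_one_add_sq_rpow {a : ℝ} (ha : 1 < a) :
    Integrable fun v : ℝ ↦ (1 + v ^ 2) ^ (-a / 2) := by
  have h := integrable_rpow_neg_one_add_norm_sq (E := ℝ) (μ := volume) (r := a)
    (by simp [ha])
  refine h.congr (Eventually.of_forall fun v ↦ ?_)
  simp [Real.norm_eq_abs, sq_abs]

/-- The dilated and translated kernel: `|u + w|^{-a}` as `(η²)^{-a/2} (1 + ((u + x)/η)²)^{-a/2}`.
[folklore] -/
theorem norm_ofReal_add_rpow_neg_eq (a u : ℝ) :
    ‖(u : ℂ) + w‖ ^ (-a) =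
      w.im ^ (-a) * (1 + (w.im⁻¹ * (u + w.re)) ^ 2) ^ (-a / 2) := by
  have hη : 0 < w.im := hw
  rw [norm_ofReal_add_rpow_neg]
  have h1 : (u + w.re) ^ 2 + w.im ^ 2 = w.im ^ 2 * (1 + (w.im⁻¹ * (u + w.re)) ^ 2) := by
    field_simp
    ring
  rw [h1, Real.mul_rpow (by positivity) (by positivity)]
  congr 1
  rw [← Real.rpow_natCast, ← Real.rpow_mul hη.le]
  congr 1
  push_cast
  ring

/-- **`u ↦ |u + w|^{-a}` is integrable on `ℝ` for `a > 1`.** [folklore] -/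
theorem integrable_norm_ofReal_add_rpow_neg {a : ℝ} (ha : 1 < a) :
    Integrable fun u : ℝ ↦ ‖(u : ℂ) + w‖ ^ (-a) := by
  have hη : 0 < w.im := hw
  have h1 : Integrable fun u : ℝ ↦ (1 + (w.im⁻¹ * (u + w.re)) ^ 2) ^ (-a / 2) := by
    have h2 : Integrable fun u : ℝ ↦ (1 + (w.im⁻¹ * u) ^ 2) ^ (-a / 2) :=
      (integrable_one_add_sq_rpow ha).comp_mul_left' (inv_ne_zero hη.ne')
    exact Integrable.comp_add_right h2 w.re
  refine (h1.const_mul (w.im ^ (-a))).congr (Eventually.of_forall fun u ↦ ?_)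
  exact (norm_ofReal_add_rpow_neg_eq hw a u).symm

/-- **`∫_ℝ |u + w|^{-a} du = (Im w)^{1-a} ∫_ℝ (1 + v²)^{-a/2} dv`** (translate by `Re w` and
dilate by `Im w`; both sides are finite exactly when `a > 1`). [folklore] -/
theorem integral_norm_ofReal_add_rpow_neg (a : ℝ) :
    ∫ u : ℝ, ‖(u : ℂ) + w‖ ^ (-a) = w.im ^ (1 - a) * ∫ v : ℝ, (1 + v ^ 2) ^ (-a / 2) := by
  have hη : 0 < w.im := hw
  calc ∫ u : ℝ, ‖(u : ℂ) + w‖ ^ (-a)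
      = ∫ u : ℝ, w.im ^ (-a) * (1 + (w.im⁻¹ * (u + w.re)) ^ 2) ^ (-a / 2) :=
        integral_congr_ae (Eventually.of_forall fun u ↦ norm_ofReal_add_rpow_neg_eq hw a u)
    _ = w.im ^ (-a) * ∫ u : ℝ, (1 + (w.im⁻¹ * (u + w.re)) ^ 2) ^ (-a / 2) := integral_const_mul _ _
    _ = w.im ^ (-a) * ∫ u : ℝ, (1 + (w.im⁻¹ * u) ^ 2) ^ (-a / 2) := by
        congr 1
        exact integral_add_right_eq_self (fun u ↦ (1 + (w.im⁻¹ * u) ^ 2) ^ (-a / 2)) w.re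
    _ = w.im ^ (-a) * (|w.im| • ∫ v : ℝ, (1 + v ^ 2) ^ (-a / 2)) := by
        rw [Measure.integral_comp_inv_mul_left (fun v ↦ (1 + v ^ 2) ^ (-a / 2)) w.im]
    _ = w.im ^ (1 - a) * ∫ v : ℝ, (1 + v ^ 2) ^ (-a / 2) := by
        rw [abs_of_pos hη, smul_eq_mul, ← mul_assoc, show (1 - a) = (-a) + 1 by ring,
          Real.rpow_add hη, Real.rpow_one]

omit hw in
/-- The constant `I(a) = ∫_ℝ (1 + v²)^{-a/2} dv` is non-negative. [folklore] -/
theorem integral_one_add_sq_rpow_nonneg (a : ℝ) : 0 ≤ ∫ v : ℝ, (1 + v ^ 2) ^ (-a / 2) :=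
  integral_nonneg fun v ↦ Real.rpow_nonneg (by positivity) _

end Integral

/-! ### The row bound `∑_d ‖∇²k(w, s; d)‖ ≪ (Im w)^{-2-2σ}` -/

section RowBound

variable {w : ℂ} (hw : 0 < w.im)
include hw

/-- `∫_{d-2}^{d} ‖k₂‖ ≤ 5(1+‖s‖)² e^{2π|Im s|} ∫_{d-2}^{d} |u+w|^{-3-2σ} du`. [folklore] -/
theorem integral_norm_rowKernel₂_le (s : ℂ) (d : ℝ) :
    ∫ u in (d - 2)..d, ‖rowKernel₂ w s u‖ ≤
      5 * (1 + ‖s‖) ^ 2 * Real.exp (2 * π * |s.im|) *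
        ∫ u in (d - 2)..d, ‖(u : ℂ) + w‖ ^ (-3 - 2 * s.re) := by
  rw [← intervalIntegral.integral_const_mul]
  have hc1 : Continuous fun u ↦ ‖rowKernel₂ w s u‖ := (continuous_rowKernel₂ hw s).norm
  have hc2 : Continuous fun u : ℝ ↦ ‖(u : ℂ) + w‖ ^ (-3 - 2 * s.re) :=
    (continuous_ofReal.add continuous_const).norm.rpow_const fun u ↦
      Or.inl (norm_pos_iff.mpr (ofReal_add_ne_zero hw u)).ne'
  exact intervalIntegral.integral_mono_on (by linarith) (hc1.intervalIntegrable _ _)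
    ((continuous_const.mul hc2).intervalIntegrable _ _) fun u _ ↦ norm_rowKernel₂_le hw s u

/-- **The row bound**: for `σ = Re s > -1`, `d ↦ ‖∇²k(w, s; d)‖` is summable over `ℤ` and
`∑_d ‖k(d-2) - 2k(d-1) + k(d)‖ ≤ 10 (1+‖s‖)² e^{2π|Im s|} I(3+2σ) (Im w)^{-2-2σ}` with
`I(a) = ∫_ℝ (1+v²)^{-a/2} dv` (FTC twice, `‖k₂‖ ≪ |u+w|^{-3-2σ}`, `∑_d ∫_{d-2}^d = 2∫_ℝ`, and the
dilation). [folklore] -/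
theorem tsum_norm_secondDiff_rowKernel_le {s : ℂ} (hs : -1 < s.re) :
    Summable (fun d : ℤ ↦
      ‖rowKernel w s ((d : ℝ) - 2) - 2 * rowKernel w s ((d : ℝ) - 1) + rowKernel w s d‖) ∧
    ∑' d : ℤ, ‖rowKernel w s ((d : ℝ) - 2) - 2 * rowKernel w s ((d : ℝ) - 1) + rowKernel w s d‖ ≤
      10 * (1 + ‖s‖) ^ 2 * Real.exp (2 * π * |s.im|) *
        (∫ v : ℝ, (1 + v ^ 2) ^ (-(3 + 2 * s.re) / 2)) * w.im ^ (-2 - 2 * s.re) := by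
  set a : ℝ := 3 + 2 * s.re with ha
  have ha1 : 1 < a := by rw [ha]; linarith
  set C : ℝ := 5 * (1 + ‖s‖) ^ 2 * Real.exp (2 * π * |s.im|) with hC
  have hC0 : 0 ≤ C := by positivity
  -- the majorant family and its sum
  set g : ℝ → ℝ := fun u ↦ ‖(u : ℂ) + w‖ ^ (-a) with hg
  have hgi : Integrable g := integrable_norm_ofReal_add_rpow_neg hw ha1
  have hsum := (hasSum_intervalIntegral_two_int hgi).mul_left C
  have hexp : -3 - 2 * s.re = -a := by rw [ha]; ring
  have hle : ∀ d : ℤ, ‖rowKernel w s ((d : ℝ) - 2) - 2 * rowKernel w s ((d : ℝ) - 1) +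
      rowKernel w s d‖ ≤ C * ∫ u in ((d : ℝ) - 2)..d, g u := by
    intro d
    refine (norm_secondDiff_rowKernel_le_integral hw s d).trans ?_
    have := integral_norm_rowKernel₂_le hw s d
    rwa [hexp] at this
  have hnn : ∀ d : ℤ, 0 ≤ ‖rowKernel w s ((d : ℝ) - 2) - 2 * rowKernel w s ((d : ℝ) - 1) +
      rowKernel w s d‖ := fun _ ↦ norm_nonneg _
  have hS : Summable (fun d : ℤ ↦
      ‖rowKernel w s ((d : ℝ) - 2) - 2 * rowKernel w s ((d : ℝ) - 1) + rowKernel w s d‖) :=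
    Summable.of_nonneg_of_le hnn hle hsum.summable
  refine ⟨hS, ?_⟩
  calc ∑' d : ℤ, ‖rowKernel w s ((d : ℝ) - 2) - 2 * rowKernel w s ((d : ℝ) - 1) + rowKernel w s d‖
      ≤ ∑' d : ℤ, C * ∫ u in ((d : ℝ) - 2)..d, g u := hS.tsum_le_tsum hle hsum.summable
    _ = C * ((2 : ℝ) • ∫ u, g u) := hsum.tsum_eq
    _ = 10 * (1 + ‖s‖) ^ 2 * Real.exp (2 * π * |s.im|) *
          (∫ v : ℝ, (1 + v ^ 2) ^ (-(3 + 2 * s.re) / 2)) * w.im ^ (-2 - 2 * s.re) := by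
        rw [hg, integral_norm_ofReal_add_rpow_neg hw a, smul_eq_mul, hC, ha,
          show (1 - (3 + 2 * s.re)) = -2 - 2 * s.re by ring]
        ring

end RowBound

end Literature.NumberTheory.EllipticCurves.ModularForms
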